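import Summits.NavierStokesRegularity.NavierStokesRegularity.Theorems.SoloSalvageWu2026Closes0897
import HarnessLib

/-!
# W. Wu 2026 (arXiv:2608.22471v1), Claims lane: the typed headline `ClaimedTheorem` / `ClaimedCor`
# of `Literature/Claims/NS/Wu2026.lean` hold BY NAME

The Claims-lane file `Literature/Claims/NS/Wu2026.lean` types the preprint's headline as
`ClaimedTheorem := Literature.Analysis.FluidPDE.Wu2026_thm11` (Thm 1.1) and
`ClaimedCor := Literature.Analysis.FluidPDE.Wu2026_cor12` (Cor 1.2), and reduces them to fourteen
`Step_*` binders; all fourteen are now theorems of the tree (`…Theorems.Wu2026Salvage.step_*`, cell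
pub/ns-inputs A3, 2026-08-27/28) and `…Closes0897` records the bare discharges `wu2026_thm11`,
`wu2026_cor12`.  This file only adds the two BY-NAME discharges the Claims-lane census reads
(`claimedTheorem_holds`, `claimedCor_holds`), so that no `def … : Prop` of the Wu Claims file is left
without a theorem of literally that type (cf. kits/LABEL-0897-cone.md §B in pub/ns-inputs).

WHAT THIS IS NOT: not a claim about NS regularity or blow-up; Wu's theorem is a Liouville statement for
STEADY flows with critically decaying vorticity, re-proved from hypotheses typed out of an unrefereed
preprint; the summit is untouched.
-/

set_option linter.dupNamespace false

noncomputable section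

namespace Summit.NavierStokesRegularity.NavierStokesRegularity.Theorems.Wu2026Salvage

/-- **Wu 2026, Theorem 1.1 as the Claims lane types it** (`Literature.Claims.NS.Wu2026.ClaimedTheorem`,
definitionally `Wu2026_thm11`): holds, by `wu2026_thm11`. [cite: Wu2026, Thm. 1.1 p.2 l.30–37] -/
theorem claimedTheorem_holds : Literature.Claims.NS.Wu2026.ClaimedTheorem :=
  wu2026_thm11

/-- **Wu 2026, Corollary 1.2 as the Claims lane types it** (`Literature.Claims.NS.Wu2026.ClaimedCor`,
definitionally `Wu2026_cor12`): holds, by `wu2026_cor12`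
(equivalently `claimedCor_of_claimedTheorem claimedTheorem_holds`). [cite: Wu2026, Cor. 1.2 p.2 l.42–56] -/
theorem claimedCor_holds : Literature.Claims.NS.Wu2026.ClaimedCor :=
  wu2026_cor12

end Summit.NavierStokesRegularity.NavierStokesRegularity.Theorems.Wu2026Salvage

end
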